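import Summits.Langlands.Langlands.Theorems.IrreducibilityBySelfDualityPairLBoundaryJSGlobalPairTranslateGen

/-!
# The twisted global Rankin–Selberg theorem for a pair, Tate's character of any conductor off `S'`,
# with a general test function

Summit `Langlands`, sub-problem `Langlands`, helper file under `Theorems/` supporting the crux
`PairLBoundaryJS` (stmt-Langlands-13622, Arthur–Clozel (1989), Ch. 3, (2.2)), line `Sketch`,
skeleton v10: stub `stub_global_pair_twisted_translate_gen`.

`stub_global_pair_twisted_translate_gen` (**main**) is the tree theorem
`Literature.NumberTheory.Automorphic.exists_entire_eq_partialPairL_mul_setIntegral_pair_twisted_translate`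
(`PairLFunctionNeConjGlobalRankinSelbergTranslate`: pairs with `ω_π ω̄_σ ≠ 1`, Tate's character `ψ_K` of
ARBITRARY local conductor off `S'`, realised by a Whittaker-shift torus element `τ` with last entry `1`
and the entire nowhere-zero weight `w_s(τ) = torusWeightC n K s τ`; Cogdell (2004), §2.3 p. 211,
Thm. 2.1–2.2, §3.1; Jacquet–Shalika (1981), §4) with ONE change: the frozen standard test function
`Φ = standardTestFun n K Φ_∞ = Φ_∞ ⊗ 𝟙_{𝒪̂ⁿ}` is replaced by an arbitrary real test function
`Φ : 𝔸_Kⁿ → ℝ` which is continuous, `≥ 0`, Schwartz–Bruhat, and spherical off `S'` only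
(`IsLastRowSphericalAt n K Φ v` and support in the `v`-integral vectors at every `v ∉ S'`) — the shape
`Φ = Φ_∞ ⊗ Φ_{S'} ⊗ 𝟙^{S'}` of the printed method (Jacquet–Shalika (1981), (5.1); Cogdell (2004),
§2.3, §4.1), which leaves the local Schwartz–Bruhat data at the bad places `S'` free.

Proof: verbatim the tree's. The three analytic inputs — the twisted unfolding on the strip
`exists_rankinSelbergIntegralTwisted_star_eq_mul_rankinSelbergTorusPairIntegralC`, the entire
continuation `exists_entire_eq_rankinSelbergIntegralTwisted` (the mirabolic Eisenstein series twisted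
by `η ≠ 1` has no poles) and the finiteness
`rankinSelbergTorusIntegral_whittakerCoeff_ne_top_of_mem_piSchwartzBruhat` — are already stated for a
general Schwartz–Bruhat `Φ ≥ 0`; the final translated Euler factorisation is the sibling file's
`GlobalPairTranslateGen.rankinSelbergTorusPairIntegralC_whittakerCoeff_eq_partialPairL_mul_translate_of_spherical`
(`IrreducibilityBySelfDualityPairLBoundaryJSGlobalPairTranslateGen`, imported), the general-`Φ` version
of `rankinSelbergTorusPairIntegralC_whittakerCoeff_eq_partialPairL_mul_translate`
(`RankinSelbergUnfoldedEulerCuspidalPairsTranslate`): the substitution `a ↦ τ a`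
(`rankinSelbergTorusPairIntegralC_eq_torusWeightC_mul_translate`) followed by the abstract factorisation
`rankinSelbergTorusPairIntegralC_eq_mul_setIntegral_of_hasProd`, which is stated for such `Φ`.

## References

* J. W. Cogdell, *Analytic theory of L-functions for GL_n*, in *An Introduction to the Langlands
  Program* (2004), §2.3 Thm. 2.1–2.2 and p. 211, §3.1, §4.1–4.2 [CogdellAnalyticTheory2004].
* H. Jacquet, J. A. Shalika, *On Euler products and the classification of automorphic
  representations I*, Amer. J. Math. 103 (1981), §2, §4, Lemma 4.2, (4.4)–(4.6), Thm. 4.8, (5.1)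
  [JacquetShalikaAJM1981].
* C. Mœglin, J.-L. Waldspurger, *Le spectre résiduel de GL(n)*, Ann. Sci. ÉNS 22 (1989), Appendice,
  Corollaire (i)(b), p. 667 [MoeglinWaldspurger1989].
-/

noncomputable section

-- `Summit.Langlands.Langlands.…` (summit = sub-problem name, D-0017 layout) trips `dupNamespace`
set_option linter.dupNamespace false

open scoped MatrixGroups Topology Pointwise ENNReal NNReal ComplexConjugate InnerProductSpace
open NumberField IsDedekindDomain MeasureTheory Measure Matrix Set Filter
open Literature.NumberTheory.Automorphic AdelicGroupData
open Literature.NumberTheory.GaloisRepresentations (ideleGroup HeckeCharacter)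

-- the automorphic quotient carries the tree's Borel σ-algebra, not Mathlib's quotient σ-algebra
attribute [-instance] Quotient.instMeasurableSpace QuotientGroup.measurableSpace

-- the house local instances, exactly as in `RankinSelbergUnfoldingIdentity`
attribute [local instance] adelicBorel borelSpace_adelic locallyCompactSpace_adelic secondCountableTopology_gl_adelic
  glAdeleBorel borelSpace_glAdele borelSpace_ideleGroup secondCountableTopology_ideleGroup

namespace Summit.Langlands.Langlands.Theorems.GlobalPairTwistedTranslateGen

open ValuativeRel

/-- **The global half of Mœglin–Waldspurger's Corollaire (i)(b) for pairs with `ω_π ω_{π'}⁻¹ ≠ 1`,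
Tate's character of any local conductor off `S'`, general test function.** There is a constant `C > 0`,
depending only on the Haar measures, such that for all cuspidal automorphic representations `π`, `π'`
of `GL_n(𝔸_K)` (`0 < n`) with Satake families `α`, `γ` off `S`, whose smoothed forms transform under the
centre through unitary `ω⁻¹`, `ω'⁻¹` with `η = ω ω'⁻¹ ≠ 1` trivial on `A_G`, all `f ∈ π`, `f' ∈ π'`,
every ideal `𝔫₀ ≠ 0` and test function `θ` left invariant under `K(𝔫₀)`, every set of finite places
`S' ⊇ S` off which `v ∤ 𝔫₀`, every torus element `τ` with last entry `1` realising at every `v ∉ S'` a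
diagonal shift `diag(d)` of constant ratio `a_v` for which `ψ_{K,v}(a_v ·)` has conductor `𝒪_v`, all
enumerations `x`, `y` of `α`, `γ` off `S'`, and every real test function `Φ : 𝔸_Kⁿ → ℝ` which is
continuous, `≥ 0`, Schwartz–Bruhat and spherical off `S'` (`IsLastRowSphericalAt` and supported in the
`v`-integral vectors at every `v ∉ S'`), there is an **entire** function `F` with

* `F(s) = I_η(s; S̄_θ f', S_θ f, Φ)` for `re s > 1` (`exists_entire_eq_rankinSelbergIntegralTwisted`:
  the twisted Eisenstein series has no poles, Jacquet–Shalika (1981), Lemma 4.2);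
* `F(s) = C · w_s(τ) · partialPairL S' α γ̄ s · ∫_{B({v ∉ S'}) × K} W_φ(diag τ ·) W̄_{φ'}(diag τ ·)
  Φ(e_n ·) |det|^s δ_B⁻¹` for `1 < re s < 2` — unfolding on the strip
  (`exists_rankinSelbergIntegralTwisted_star_eq_mul_rankinSelbergTorusPairIntegralC`) and the
  translated Euler factorisation of the pair for a test function spherical off `S'`
  (`GlobalPairTranslateGen.rankinSelbergTorusPairIntegralC_whittakerCoeff_eq_partialPairL_mul_translate_of_spherical`).

The tree's `exists_entire_eq_partialPairL_mul_setIntegral_pair_twisted_translate`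
(`PairLFunctionNeConjGlobalRankinSelbergTranslate`) is the case `Φ = Φ_∞ ⊗ 𝟙_{𝒪̂ⁿ}`; the proof is
verbatim the same. Cogdell (2004), Thm. 2.1–2.2 with §2.3 p. 211, §3.1, §4.1; Jacquet–Shalika (1981),
§4, (5.1); Mœglin–Waldspurger (1989), Appendice, Cor. (i)(b) for `ω_π ω̄_σ ≠ 1`. -/
theorem stub_global_pair_twisted_translate_gen :
    ∀ {n : ℕ} {K : Type} [Field K] [NumberField K]
      [MeasurableSpace (AdeleRing (𝓞 K) K)] [BorelSpace (AdeleRing (𝓞 K) K)] (_hn : 0 < n)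
      (μ' : Measure (AdelicGroupData.gl n K).automorphicQuotient)
      [(AdelicGroupData.gl n K).IsAutomorphicMeasure μ']
      (νI : Measure (ideleGroup K)) [νI.IsHaarMeasure]
      (νA : Measure (Fin n → ideleGroup K)) [IsHaarMeasure νA]
      (νK : Measure ↥(maximalCompactAdelic n K)) [IsHaarMeasure νK]
      (ν₀ : Measure ↥(adelicUnipotent n K)) [IsHaarMeasure ν₀],
    ∃ C : ℝ, 0 < C ∧
      ∀ (P Q : CuspidalAutomorphicRepGL n K μ') (f : P.1.toSubmodule) (f' : Q.1.toSubmodule)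
        {ω ω' η : HeckeCharacter K}, ω.IsUnitary → ω'.IsUnitary → η = ω * ω'⁻¹ → η ≠ 1 →
      ∀ (hη₀ : ∀ t : ℝ≥0ˣ, η (posRealIdele K t) = 1)
        {S : Set (HeightOneSpectrum (𝓞 K))} {α γ : SatakeFamily K}, IsSatakeFamilyOf P S α →
        IsSatakeFamilyOf Q S γ →
      ∀ {𝔫₀ : Ideal (𝓞 K)}, 𝔫₀ ≠ 0 →
      ∀ {θ : (AdelicGroupData.gl n K).Adelic → ℝ}, IsTestFunctionGL n K θ →
        (∀ k : (AdelicGroupData.gl n K).Adelic, k ∈ principalCongruenceLevel n K 𝔫₀ →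
          ∀ g : (AdelicGroupData.gl n K).Adelic, θ (k * g) = θ g) →
        (∀ (z : ideleGroup K) (g : GL (Fin n) (AdeleRing (𝓞 K) K)),
          smoothedForm θ (f : (AdelicGroupData.gl n K).L2 μ')
              ((AdelicGroupData.gl n K).toAutomorphicQuotient (Matrix.GeneralLinearGroup.scalar (Fin n) z * g)) =
            ((ω z : ℂˣ) : ℂ)⁻¹ * smoothedForm θ (f : (AdelicGroupData.gl n K).L2 μ')
              ((AdelicGroupData.gl n K).toAutomorphicQuotient g)) →
        (∀ (z : ideleGroup K) (g : GL (Fin n) (AdeleRing (𝓞 K) K)),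
          smoothedForm θ (f' : (AdelicGroupData.gl n K).L2 μ')
              ((AdelicGroupData.gl n K).toAutomorphicQuotient (Matrix.GeneralLinearGroup.scalar (Fin n) z * g)) =
            ((ω' z : ℂˣ) : ℂ)⁻¹ * smoothedForm θ (f' : (AdelicGroupData.gl n K).L2 μ')
              ((AdelicGroupData.gl n K).toAutomorphicQuotient g)) →
      ∀ {S' : Set (HeightOneSpectrum (𝓞 K))}, S ⊆ S' → (∀ v ∉ S', ¬ v.asIdeal ∣ 𝔫₀) →
      ∀ (τ : Fin n → ideleGroup K), lastEntry τ = 1 →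
        (∀ v ∉ S', ∃ (d : Fin n → (v.adicCompletion K)ˣ) (a : (v.adicCompletion K)ˣ),
          localComponent v (glDiagonal n (AdeleRing (𝓞 K) K) τ) = diagonalGL (Fin n) (v.adicCompletion K) d ∧
          (∀ i j : Fin n, (i : ℕ) + 1 = j →
            (d i : v.adicCompletion K) * ((d j)⁻¹ : (v.adicCompletion K)ˣ) = a) ∧
          (∀ c ∈ 𝒪[v.adicCompletion K], (adeleAddChar K).adicComponent v (a * c) = 1) ∧
          ∀ ϖ : v.adicCompletion K, Valued.v ϖ = WithZero.exp (-1 : ℤ) →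
            ∃ c ∈ 𝒪[v.adicCompletion K], (adeleAddChar K).adicComponent v (a * (ϖ⁻¹ * c)) ≠ 1) →
      ∀ {x y : HeightOneSpectrum (𝓞 K) → Fin n → ℂ},
        (∀ v ∉ S', (Finset.univ : Finset (Fin n)).val.map (x v) = α v) →
        (∀ v ∉ S', (Finset.univ : Finset (Fin n)).val.map (y v) = γ v) →
      ∀ {Φ : (Fin n → AdeleRing (𝓞 K) K) → ℝ}, Continuous Φ → (∀ y, 0 ≤ Φ y) →
        (fun y => ((Φ y : ℝ) : ℂ)) ∈ piSchwartzBruhat K (Fin n) →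
        (∀ v ∉ S', IsLastRowSphericalAt n K Φ v) →
        (∀ v ∉ S', ∀ y : Fin n → AdeleRing (𝓞 K) K, Φ y ≠ 0 → ∀ j, Valued.v ((y j).2 v) ≤ 1) →
      ∃ F : ℂ → ℂ, Differentiable ℂ F ∧
        (∀ s : ℂ, 1 < s.re → F s =
          rankinSelbergIntegralTwisted μ' νI hη₀ (fun y => ((Φ y : ℝ) : ℂ)) s
            (star (smoothedForm θ (f' : (AdelicGroupData.gl n K).L2 μ')))
            (smoothedForm θ (f : (AdelicGroupData.gl n K).L2 μ'))) ∧
        (∀ s : ℂ, 1 < s.re → s.re < 2 → F s = (C : ℂ) * (torusWeightC n K s τ *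
          (partialPairL S' α (fun v => (γ v).map conj) s *
            ∫ p in unitBox {v | v ∉ S'} ×ˢ Set.univ, torusPairIntegrandC n K
              (fun g => whittakerCoeff ν₀ (unipotentTateDomain n K) (adeleAddChar K)
                (invQuot (AdelicGroupData.gl n K) (smoothedForm θ (f : (AdelicGroupData.gl n K).L2 μ')))
                (glDiagonal n (AdeleRing (𝓞 K) K) τ * g))
              (fun g => (star (whittakerCoeff ν₀ (unipotentTateDomain n K) (adeleAddChar K)
                (invQuot (AdelicGroupData.gl n K) (smoothedForm θ (f' : (AdelicGroupData.gl n K).L2 μ')))))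
                (glDiagonal n (AdeleRing (𝓞 K) K) τ * g))
              Φ s p ∂(νA.prod νK)))) := by
  intro n K _ _ _ _ hn μ' _ νI _ νA _ νK _ ν₀ _
  classical
  haveI : T2Space (GL (Fin n) (AdeleRing (𝓞 K) K)) := t2Space_gl n K
  haveI : LocallyCompactSpace (GL (Fin n) (AdeleRing (𝓞 K) K)) :=
    AdelicGroupData.locallyCompactSpace_generalLinearGroup_adeleRing K (Fin n)
  haveI : SecondCountableTopology (GL (Fin n) (AdeleRing (𝓞 K) K)) :=
    secondCountableTopology_generalLinearGroup_adeleRing K (Fin n)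
  haveI hν₀R : ν₀.IsMulRightInvariant := isMulRightInvariant_of_isHaarMeasure_adelicUnipotent ν₀
  haveI hνIR : νI.IsMulRightInvariant := by
    haveI := isInvInvariant_of_isHaarMeasure_ideleGroup (K := K) νI
    infer_instance
  haveI := locallyCompactSpace_ideleGroup K
  haveI : CompactSpace ↥(maximalCompactAdelic n K) :=
    isCompact_iff_compactSpace.1 (isCompact_maximalCompactAdelic n K)
  obtain ⟨C, hC, hunf⟩ :=
    exists_rankinSelbergIntegralTwisted_star_eq_mul_rankinSelbergTorusPairIntegralC (n := n) (K := K) hn μ' νI νA νK ν₀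
  refine ⟨C, hC, fun P Q f f' {ω ω' η} hωu hω'u hηeq hη1 hη₀ {S} {α} {γ} hα hγ {𝔫₀} h𝔫₀ {θ} hθ hθK hωf hω'f'
    {S'} hSS' hS' τ hτ hτψ {x} {y} hx hy {Φ} hΦc hΦ0 hΦS hΦsph hΦv => ?_⟩
  -- the test function: `g ↦ Φ(e_n g)` is measurable
  have hΦm : Measurable fun g : GL (Fin n) (AdeleRing (𝓞 K) K) => Φ (lastRow n K g) :=
    (hΦc.comp continuous_lastRow).measurable
  -- the twisting character is unitary and non-trivial on `𝕀_K¹`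
  have hηu : η.IsUnitary := by
    intro a
    rw [hηeq, HeckeCharacter.mul_apply, HeckeCharacter.inv_apply, Units.val_mul, Units.val_inv_eq_inv_val,
      norm_mul, norm_inv, hωu a, hω'u a, inv_one, mul_one]
  have hηb : ∃ b : ideleGroup K, IdeleClassGroup.ideleNorm K b = 1 ∧ η b ≠ 1 :=
    η.exists_ideleNorm_eq_one_and_ne_one_of_map_posRealIdele hη₀ hη1
  -- the entire continuation of `I_η`
  have hφtc : Continuous (smoothedForm θ (f : (AdelicGroupData.gl n K).L2 μ')) :=
    continuous_smoothedForm hθ.continuous hθ.hasCompactSupport _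
  have hφt'c : Continuous (smoothedForm θ (f' : (AdelicGroupData.gl n K).L2 μ')) :=
    continuous_smoothedForm hθ.continuous hθ.hasCompactSupport _
  have hφd : IsRapidlyDecreasingGL n K (invQuot (AdelicGroupData.gl n K) (smoothedForm θ (f : (AdelicGroupData.gl n K).L2 μ'))) :=
    isRapidlyDecreasingGL_invQuot_smoothedForm hθ (P.2.1 f.2)
  have hφ'd : IsRapidlyDecreasingGL n K (invQuot (AdelicGroupData.gl n K)
      (star (smoothedForm θ (f' : (AdelicGroupData.gl n K).L2 μ')))) :=
    isRapidlyDecreasingGL_invQuot_star (isRapidlyDecreasingGL_invQuot_smoothedForm hθ (Q.2.1 f'.2))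
  obtain ⟨F, hF, hFI⟩ := exists_entire_eq_rankinSelbergIntegralTwisted (K := K) νI hn μ' hηu hηb hη₀ hΦS
    (show Continuous (star (smoothedForm θ (f' : (AdelicGroupData.gl n K).L2 μ'))) from continuous_star.comp hφt'c)
    hφtc hφ'd hφd
  refine ⟨F, hF, hFI, fun s hs1 hs2 => ?_⟩
  -- Tate's character and fundamental domain
  have hψ : IsGlobalAddChar K (adeleAddChar K) := isGlobalAddChar_adeleAddChar (K := K)
  have h𝓕 : IsFundamentalDomain ↥(rationalUnipotent n K) (unipotentTateDomain n K) ν₀ :=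
    isFundamentalDomain_unipotentTateDomain ν₀
  have h𝓕c : IsCompact (closure (unipotentTateDomain n K)) := isCompact_closure_unipotentTateDomain
  have h𝓕m : MeasurableSet (unipotentTateDomain n K) := measurableSet_unipotentTateDomain
  -- finiteness of the two real unfolded integrals at `re s`
  have hfin : rankinSelbergTorusIntegral n K νA νK
      (whittakerCoeff ν₀ (unipotentTateDomain n K) (adeleAddChar K)
        (invQuot (AdelicGroupData.gl n K) (smoothedForm θ (f : (AdelicGroupData.gl n K).L2 μ')))) Φ s.re ≠ ⊤ :=
    rankinSelbergTorusIntegral_whittakerCoeff_ne_top_of_mem_piSchwartzBruhat hn νA νK ν₀ P f hθ hΦS hΦ0 hΦm hs1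
  have hfin' : rankinSelbergTorusIntegral n K νA νK
      (whittakerCoeff ν₀ (unipotentTateDomain n K) (adeleAddChar K)
        (invQuot (AdelicGroupData.gl n K) (smoothedForm θ (f' : (AdelicGroupData.gl n K).L2 μ')))) Φ s.re ≠ ⊤ :=
    rankinSelbergTorusIntegral_whittakerCoeff_ne_top_of_mem_piSchwartzBruhat hn νA νK ν₀ Q f' hθ hΦS hΦ0 hΦm hs1
  -- unfold on the strip and factor, translating by `τ`
  rw [hFI s hs1, hunf P Q f f' hωu hω'u hηeq hη1 hη₀ hθ hωf hω'f' hΦS hΦ0 hΦm hs1 hs2,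
    GlobalPairTranslateGen.rankinSelbergTorusPairIntegralC_whittakerCoeff_eq_partialPairL_mul_translate_of_spherical
      hn P Q hα hγ h𝔫₀ hθ.continuous hθ.hasCompactSupport hθK f f' h𝓕 h𝓕m h𝓕c hψ hSS' hS' τ hτ hτψ hx hy hΦ0
      hΦsph hΦv hΦm νA νK hs1 hfin hfin']

end Summit.Langlands.Langlands.Theorems.GlobalPairTwistedTranslateGen

end
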